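import Mathlib
import Summits.Ventures.PercRepro2.RowC1Sym
import Summits.Ventures.PercRepro2.TriCovCounterexample6

/-!
# The cross members of the symmetric family are FALSE on six vertices — a kernel-checked
counterexample (blind cell PercRepro2, p2 g30; proofs/P2-G30-C1.md §6)

RowC1Sym.lean types `RowC1.SymBound p ends a₁ a₂ o b x y`:
`Cov_μ(1[b ∈ U], 1[o ∈ U]) ≥ −μ(b ↔ x)·μ(o ↔ y)` under `μ = P(· | a₁ ↮ a₂)`, cleared by `P(Q)²`.
The SAME-SIDE members `(x, y) = (a₁, a₁)` and `(a₂, a₂)` survive every census (kit j328129: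
0 / 432,024 log-odds descents on 144,008 graphs `n = 6–8`); the CROSS members `(a₁, a₂)` and `(a₂, a₁)`
are FALSE (187 and 165 exact negatives there).  Here the cross member `(x, y) = (a₁, a₂)` is refuted in
the kernel on the graph `g6t` of TriCovCounterexample6.lean (p2 g28) — edges `02, 04, 13, 14, 15, 24, 34, 35`
on `Fin 6`, marks `a₁, a₂, o, b = 0, 1, 2, 5`, weights `90, 99, 80, 99, 85, 10, 20, 20` over `100` — by
the same method (reachability tables, integer sums over the `256` configurations over `100^8`): the
cleared difference `P(Q)·P(Q, b ∈ U, o ∈ U) + P(Q, b ∈ C₁)·P(Q, o ∈ C₂) − P(Q, b ∈ U)·P(Q, o ∈ U)`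
equals **`−542245359 / 6250000000000000000 ≈ −8.68·10⁻¹¹`** (`symBound_g6t_eq`) — the value of (TRI-COV)
there, because `P(Q, b ∈ C₁, o ∈ C₂) = 0` on `g6t` (`b ∈ C₁` and `o ∈ C₂` would join the roots through the
hub `4`), and `S_{a₁,a₂}` is (TRI-COV) plus `P(Q)·P(Q, b ∈ C₁, o ∈ C₂)`.  Own work; std axioms.
-/

namespace Summit.Ventures.PercRepro2

namespace SymCex6

open TriCovCex6

/-- `{b ∈ U} ∩ Q` in the shape of `SymBound`, as a Boolean. -/
def bUB (ω : Config (Fin 8)) : Bool := (bLB ω || bHB ω) && QB ω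
/-- `{o ∈ U} ∩ Q`, as a Boolean. -/
def oUB (ω : Config (Fin 8)) : Bool := (oLB ω || oHB ω) && QB ω
/-- `{o ∈ U} ∩ {b ∈ U} ∩ Q`, as a Boolean. -/
def bUoUB (ω : Config (Fin 8)) : Bool := ((oLB ω || oHB ω) && (bLB ω || bHB ω)) && QB ω
/-- `{b ∈ C₁} ∩ Q`, as a Boolean. -/
def bLQB (ω : Config (Fin 8)) : Bool := bLB ω && QB ω

/-- Membership in `{b ∈ U} ∩ Q`, as a Boolean. -/
lemma mem_bU_iff (ω : Config (Fin 8)) :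
    ω ∈ (connEvent g6t 0 5 ∪ connEvent g6t 1 5) ∩ (connEvent g6t 0 1)ᶜ ↔ bUB ω = true := by
  simp only [Set.mem_inter_iff, Set.mem_union, mem_Q_iff, mem_bL_iff, mem_bH_iff, bUB,
    Bool.and_eq_true, Bool.or_eq_true]
/-- Membership in `{o ∈ U} ∩ Q`, as a Boolean. -/
lemma mem_oU_iff (ω : Config (Fin 8)) :
    ω ∈ (connEvent g6t 0 2 ∪ connEvent g6t 1 2) ∩ (connEvent g6t 0 1)ᶜ ↔ oUB ω = true := by
  simp only [Set.mem_inter_iff, Set.mem_union, mem_Q_iff, mem_oL_iff, mem_oH_iff, oUB,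
    Bool.and_eq_true, Bool.or_eq_true]
/-- Membership in `{o ∈ U} ∩ {b ∈ U} ∩ Q`, as a Boolean. -/
lemma mem_bUoU_iff (ω : Config (Fin 8)) :
    ω ∈ (connEvent g6t 0 2 ∪ connEvent g6t 1 2) ∩ (connEvent g6t 0 5 ∪ connEvent g6t 1 5) ∩
      (connEvent g6t 0 1)ᶜ ↔ bUoUB ω = true := by
  simp only [Set.mem_inter_iff, Set.mem_union, mem_Q_iff, mem_bL_iff, mem_bH_iff, mem_oL_iff,
    mem_oH_iff, bUoUB, Bool.and_eq_true, Bool.or_eq_true]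
/-- Membership in `{b ∈ C₁} ∩ Q`, as a Boolean. -/
lemma mem_bLQ_iff (ω : Config (Fin 8)) :
    ω ∈ connEvent g6t 0 5 ∩ (connEvent g6t 0 1)ᶜ ↔ bLQB ω = true := by
  simp only [Set.mem_inter_iff, mem_Q_iff, mem_bL_iff, bLQB, Bool.and_eq_true]

/-- The integer sum of `{b ∈ U} ∩ Q`. -/
def NbU : ℕ := ∑ j ∈ Finset.range 256, if bUB (cfg j) then F j else 0
/-- The integer sum of `{o ∈ U} ∩ Q`. -/
def NoU : ℕ := ∑ j ∈ Finset.range 256, if oUB (cfg j) then F j else 0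
/-- The integer sum of `{o ∈ U} ∩ {b ∈ U} ∩ Q`. -/
def NbUoU : ℕ := ∑ j ∈ Finset.range 256, if bUoUB (cfg j) then F j else 0
/-- The integer sum of `{b ∈ C₁} ∩ Q`. -/
def NbL : ℕ := ∑ j ∈ Finset.range 256, if bLQB (cfg j) then F j else 0

/-- **The cleared `S_{a₁,a₂}` difference on `g6t` at `p8` as integer sums**. -/
theorem symBound_g6t_eq_int :
    prob p8 (connEvent g6t 0 1)ᶜ *
        prob p8 ((connEvent g6t 0 2 ∪ connEvent g6t 1 2) ∩ (connEvent g6t 0 5 ∪ connEvent g6t 1 5) ∩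
          (connEvent g6t 0 1)ᶜ) +
      prob p8 (connEvent g6t 0 5 ∩ (connEvent g6t 0 1)ᶜ) *
        prob p8 (connEvent g6t 1 2 ∩ (connEvent g6t 0 1)ᶜ) -
      prob p8 ((connEvent g6t 0 5 ∪ connEvent g6t 1 5) ∩ (connEvent g6t 0 1)ᶜ) *
        prob p8 ((connEvent g6t 0 2 ∪ connEvent g6t 1 2) ∩ (connEvent g6t 0 1)ᶜ) =
      ((NQ : ℚ) * NbUoU + (NbL : ℚ) * NS4 - (NbU : ℚ) * NoU) / 100 ^ 16 := by
  have hQ : prob p8 (connEvent g6t 0 1)ᶜ = (NQ : ℚ) / 100 ^ 8 := by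
    unfold NQ; exact prob_eq_intSum _ _ mem_Q_iff
  have h1 : prob p8 ((connEvent g6t 0 2 ∪ connEvent g6t 1 2) ∩
      (connEvent g6t 0 5 ∪ connEvent g6t 1 5) ∩ (connEvent g6t 0 1)ᶜ) = (NbUoU : ℚ) / 100 ^ 8 := by
    unfold NbUoU; exact prob_eq_intSum _ _ mem_bUoU_iff
  have h2 : prob p8 (connEvent g6t 0 5 ∩ (connEvent g6t 0 1)ᶜ) = (NbL : ℚ) / 100 ^ 8 := by
    unfold NbL; exact prob_eq_intSum _ _ mem_bLQ_iff
  have h3 : prob p8 (connEvent g6t 1 2 ∩ (connEvent g6t 0 1)ᶜ) = (NS4 : ℚ) / 100 ^ 8 := by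
    unfold NS4; exact prob_eq_intSum _ _ mem_S4_iff
  have h4 : prob p8 ((connEvent g6t 0 5 ∪ connEvent g6t 1 5) ∩ (connEvent g6t 0 1)ᶜ) =
      (NbU : ℚ) / 100 ^ 8 := by
    unfold NbU; exact prob_eq_intSum _ _ mem_bU_iff
  have h5 : prob p8 ((connEvent g6t 0 2 ∪ connEvent g6t 1 2) ∩ (connEvent g6t 0 1)ᶜ) =
      (NoU : ℚ) / 100 ^ 8 := by
    unfold NoU; exact prob_eq_intSum _ _ mem_oU_iff
  rw [hQ, h1, h2, h3, h4, h5]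
  ring

set_option maxHeartbeats 0 in
set_option maxRecDepth 100000 in
/-- **The decided integers** (`NQ`, `NS4` are those of TriCovCounterexample6.lean). -/
lemma int_values' : NbU = 151739992000000 ∧ NoU = 157129644000000 ∧
    NbUoU = 137373120000000 ∧ NbL = 118908000000 := by
  decide +kernel

/-- **The value**: the cleared `S_{a₁,a₂}` difference on `g6t` at `p8` is
`−542245359 / 6250000000000000000` (the (TRI-COV) value: `P(Q, b ∈ C₁, o ∈ C₂) = 0` on `g6t`). -/
theorem symBound_g6t_eq :
    prob p8 (connEvent g6t 0 1)ᶜ *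
        prob p8 ((connEvent g6t 0 2 ∪ connEvent g6t 1 2) ∩ (connEvent g6t 0 5 ∪ connEvent g6t 1 5) ∩
          (connEvent g6t 0 1)ᶜ) +
      prob p8 (connEvent g6t 0 5 ∩ (connEvent g6t 0 1)ᶜ) *
        prob p8 (connEvent g6t 1 2 ∩ (connEvent g6t 0 1)ᶜ) -
      prob p8 ((connEvent g6t 0 5 ∪ connEvent g6t 1 5) ∩ (connEvent g6t 0 1)ᶜ) *
        prob p8 ((connEvent g6t 0 2 ∪ connEvent g6t 1 2) ∩ (connEvent g6t 0 1)ᶜ) =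
      -542245359 / 6250000000000000000 := by
  rw [symBound_g6t_eq_int]
  obtain ⟨h1, h2, h3, h4⟩ := int_values'
  obtain ⟨h0, -, -, -, h5, -, -⟩ := int_values
  rw [h0, h1, h2, h3, h4, h5]
  norm_num

/-- **The cross member `S_{a₁,a₂}` fails on six vertices**: `RowC1.SymBound` with `(x, y) = (a₁, a₂)`
is false on `g6t` at `p8`. -/
theorem not_symBound_cross_g6t : ¬ RowC1.SymBound p8 g6t 0 1 2 5 0 1 := by
  intro h
  unfold RowC1.SymBound at h
  have := symBound_g6t_eq
  linarith

/-- **The cross member is not a theorem**: there is an admissible weight vector on `g6t` at which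
`S_{a₁,a₂}` fails. -/
theorem symBound_cross_fails_six :
    ¬ (∀ p : Fin 8 → ℚ, IsProbVec p → RowC1.SymBound p g6t 0 1 2 5 0 1) :=
  fun h => not_symBound_cross_g6t (h p8 isProbVec_p8)

end SymCex6

end Summit.Ventures.PercRepro2
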